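import Summits.BirchSwinnertonDyer.Rank1Residual.Supersingular.SignedLambdaParity
import HarnessLib

/-!
# `Λ`-algebra for the crux `SignedTransportAtTwo` (stmt-BirchSwinnertonDyer-20333, route `ThetaPartnerAtTwo`, line
# `bridge`): FROM LAYER-WISE MAZUR–TATE CONGRUENCES TO A CONGRUENCE OF SIGNED `p`-ADIC `L`-FUNCTIONS
# (lead prover bsd-wall-tp2-p1 g2; `--supports stmt-BirchSwinnertonDyer-20333`; route-independent, closes nothing)

HONEST FRAMING. Pure algebra in `Λ = ℤ_p⟦T⟧` and `𝔽_p⟦T⟧` for ANY prime `p`; nothing about any curve is asserted.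

WHAT IS PROVED, AND WHY. The analytic transfer of Iwasawa invariants between congruent forms (Greenberg–Vatsal 2000
§3, Emerton–Pollack–Weston 2006 Thm. 1; for `a_p = 0` Pollack–Weston / [GIP]) starts from congruences of SPECIAL
VALUES, i.e. of Mazur–Tate elements `θ_n` layer by layer (Vatsal 1999 Thm. (1.10): `θ_n(f) ≡ u·θ_n(g)`), and ends
with a congruence of `p`-adic `L`-functions. For the signed functions the passage is: Pollack's interpolation
`θ_n ≡ ε_n ω_n^∓ L^± (mod ω_n)` (`IsCongrModOmega`, a congruence in `Λ ⊗ ℚ_p`) on both sides turns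
"`D·Θ_n − D'·Θ'_n ∈ (p^k, ω_n)Λ`" into "`ω_n^-·(D·G·P − D'·G'·P') ∈ (p^k, ω_n)Λ`" (§3,
`omegaMinus_mul_mem_of_layerCongr`, after clearing the `p`-power denominators of the interpolation and of the
period constants against `ω_n`, which is prime to `p`: §1), and then the LIMIT ARGUMENT (§2,
`C_pow_dvd_of_forall_even`): if `ω_n^-·F ∈ (p^k, ω_n)Λ` for every even `n` then `p^k ∣ F` — because modulo `p`,
`ω_n^- ≡ T^{deg ω_n^-}` and `ω_n ≡ T^{pⁿ}` (`MazurTateReduction`), so `T^{1 + deg ω_n^+} ∣ F̄` with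
`deg ω_n^+ ≥ n/2 → ∞`, whence `F̄ = 0`, and induction on `k`. Used at `p = 2` by
`Theorems/ThetaPartnerAtTwoSignedTransportAtTwoBridgeMazurTate.lean` to drive the analytic stub of the crux down
to the Mazur–Tate level (the objects the kit numerics read). No sorry; standard axioms.

References: [Pollack2003] Prop. 6.18, Lemma 4.7, Thm. 6.17; [Vatsal1999] Thm. (1.10); [GreenbergVatsal2000] §3;
[EmertonPollackWeston2006] Thm. 1; [Washington1997] §7.1.
-/

set_option autoImplicit false
-- D-0017: single-problem summit, so `Summit.BirchSwinnertonDyer.BirchSwinnertonDyer.…` repeats a namespace BY DESIGN.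
set_option linter.dupNamespace false

noncomputable section

open scoped Classical

open Polynomial Literature.NumberTheory.EllipticCurves Literature.NumberTheory.EllipticCurves.Sprung2017
  Summit.BirchSwinnertonDyer.Rank1Residual.X1.MuLambda Summit.BirchSwinnertonDyer.Rank1Residual.Supersingular

namespace Summit.BirchSwinnertonDyer.BirchSwinnertonDyer.Theorems.SignedTransportAtTwo

variable {p : ℕ} [hp : Fact p.Prime]

/-- `red` is multiplicative. [folklore] -/
private theorem red_mul' (a b : IwasawaAlgebra p) : red (a * b) = red a * red b := map_mul _ a b

/-- `red` is additive. [folklore] -/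
private theorem red_add' (a b : IwasawaAlgebra p) : red (a + b) = red a + red b := map_add _ a b

/-- `red (C p) = 0`. [folklore] -/
private theorem red_C_p : red (PowerSeries.C (p : ℤ_[p])) = 0 := (red_eq_zero_iff _).mpr (dvd_refl _)

/-! ## §1. `ω_n` is prime to `p`: `p^c ∣ ω_n·r ⇒ p^c ∣ r`; `p`-power denominators of `ℚ_p`-constants -/

/-- `red(ω_n^-) = T^{deg ω_n^-}` in `𝔽_p⟦T⟧`. [cite: Pollack2003, Lemma 4.7 and §6.5] -/
theorem red_toIwasawa_cyclotomicOmegaMinus (n : ℕ) :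
    red (toIwasawa p (cyclotomicOmegaMinus p n)) =
      (PowerSeries.X : PowerSeries (IsLocalRing.ResidueField ℤ_[p])) ^ (cyclotomicOmegaMinus p n).natDegree := by
  rw [red_toIwasawa, map_residue_cyclotomicOmegaMinus, Polynomial.coe_pow, Polynomial.coe_X]

/-- **`ω_n` is prime to `p` in `Λ`**: `p ∣ ω_n·r ⇒ p ∣ r` (`ω_n ≡ T^{pⁿ} ≢ 0 (mod p)` and `𝔽_p⟦T⟧` is a domain).
[cite: Pollack2003, Thm. 6.17] [cite: Washington1997, §7.1] -/
theorem C_p_dvd_of_dvd_omega_mul {n : ℕ} {r : IwasawaAlgebra p}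
    (h : PowerSeries.C (p : ℤ_[p]) ∣ toIwasawa p (cyclotomicOmega p n) * r) : PowerSeries.C (p : ℤ_[p]) ∣ r := by
  rw [← red_eq_zero_iff] at h ⊢
  rw [red_mul', red_toIwasawa_cyclotomicOmega] at h
  exact (mul_eq_zero.mp h).resolve_left (pow_ne_zero _ PowerSeries.X_ne_zero)

/-- `p^c ∣ ω_n·r ⇒ p^c ∣ r`. [cite: Pollack2003, Thm. 6.17] [cite: Washington1997, §7.1] -/
theorem C_pow_dvd_of_dvd_omega_mul {n : ℕ} (c : ℕ) :
    ∀ {r : IwasawaAlgebra p}, PowerSeries.C ((p : ℤ_[p]) ^ c) ∣ toIwasawa p (cyclotomicOmega p n) * r →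
      PowerSeries.C ((p : ℤ_[p]) ^ c) ∣ r := by
  induction c with
  | zero => intro r _; rw [pow_zero, map_one]; exact one_dvd _
  | succ c ih =>
    intro r h
    have h1 : PowerSeries.C (p : ℤ_[p]) ∣ toIwasawa p (cyclotomicOmega p n) * r :=
      Dvd.dvd.trans ⟨PowerSeries.C ((p : ℤ_[p]) ^ c), by rw [← map_mul, ← pow_succ']⟩ h
    obtain ⟨r₁, rfl⟩ := C_p_dvd_of_dvd_omega_mul h1
    obtain ⟨s, hs⟩ := h
    have h2 : PowerSeries.C ((p : ℤ_[p]) ^ c) ∣ toIwasawa p (cyclotomicOmega p n) * r₁ := by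
      refine ⟨s, mul_left_cancel₀ (C_pow_ne_zero (p := p) 1) ?_⟩
      rw [pow_one]
      calc PowerSeries.C (p : ℤ_[p]) * (toIwasawa p (cyclotomicOmega p n) * r₁)
          = toIwasawa p (cyclotomicOmega p n) * (PowerSeries.C (p : ℤ_[p]) * r₁) := by ring
        _ = PowerSeries.C ((p : ℤ_[p]) ^ (c + 1)) * s := hs
        _ = PowerSeries.C (p : ℤ_[p]) * (PowerSeries.C ((p : ℤ_[p]) ^ c) * s) := by
          rw [pow_succ', map_mul, mul_assoc]
    obtain ⟨t, ht⟩ := ih h2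
    exact ⟨t, by rw [ht, pow_succ', map_mul]; ring⟩

/-- Every `x ∈ ℚ_p` has a `p`-power multiple in `ℤ_p`. [folklore] -/
theorem exists_pow_mul_eq_coe (x : ℚ_[p]) : ∃ (b : ℕ) (y : ℤ_[p]), (p : ℚ_[p]) ^ b * x = (y : ℚ_[p]) := by
  have hp1 : (1 : ℝ) < p := by exact_mod_cast hp.out.one_lt
  obtain ⟨b, hb⟩ := pow_unbounded_of_one_lt ‖x‖ hp1
  have hle : ‖(p : ℚ_[p]) ^ b * x‖ ≤ 1 := by
    rw [norm_mul, norm_pow, Padic.norm_p, inv_pow, inv_mul_le_iff₀ (pow_pos (by positivity) _), mul_one]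
    exact hb.le
  exact ⟨b, ⟨_, hle⟩, rfl⟩

/-! ## §2. The limit argument: `ω_n^-·F ∈ (p^k, ω_n)Λ` for all even `n` forces `p^k ∣ F` -/

/-- One layer, modulo `p`: `ω_n^-·F = p·q + ω_n·r` gives `T^{1 + deg ω_n^+} ∣ F̄` in `𝔽_p⟦T⟧`
(`T^{deg ω_n^-} F̄ = T^{pⁿ} r̄` and `pⁿ = 1 + deg ω_n^+ + deg ω_n^-`). [cite: Pollack2003, Lemma 4.7 and Thm. 6.17] -/
theorem X_pow_dvd_red_of_layer {n : ℕ} {F q r : IwasawaAlgebra p}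
    (h : toIwasawa p (cyclotomicOmegaMinus p n) * F =
      PowerSeries.C (p : ℤ_[p]) * q + toIwasawa p (cyclotomicOmega p n) * r) :
    (PowerSeries.X : PowerSeries (IsLocalRing.ResidueField ℤ_[p])) ^ (1 + (cyclotomicOmegaPlus p n).natDegree) ∣
      red F := by
  have hdeg := natDegree_cyclotomicOmegaPlus_add (p := p) n
  have hred := congrArg red h
  rw [red_mul', red_add', red_mul', red_mul', red_toIwasawa_cyclotomicOmegaMinus, red_toIwasawa_cyclotomicOmega,
    red_C_p, zero_mul, zero_add] at hred
  refine ⟨red r, mul_left_cancel₀ (pow_ne_zero (cyclotomicOmegaMinus p n).natDegree PowerSeries.X_ne_zero) ?_⟩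
  rw [hred, ← mul_assoc, ← pow_add]
  congr 2
  omega

/-- **The limit argument, `k = 1`**: if `ω_n^-·F ∈ (p, ω_n)Λ` for every even `n`, then `p ∣ F`
(`T^{1 + deg ω_n^+} ∣ F̄` for all even `n` and `deg ω_n^+ ≥ n/2`, so `F̄ = 0`).
[cite: GreenbergVatsal2000, §3] [cite: EmertonPollackWeston2006, Thm. 1] -/
theorem C_p_dvd_of_forall_even {F : IwasawaAlgebra p}
    (h : ∀ n : ℕ, Even n → ∃ q r : IwasawaAlgebra p, toIwasawa p (cyclotomicOmegaMinus p n) * F =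
      PowerSeries.C (p : ℤ_[p]) * q + toIwasawa p (cyclotomicOmega p n) * r) :
    PowerSeries.C (p : ℤ_[p]) ∣ F := by
  rw [← red_eq_zero_iff]
  by_contra hne
  obtain ⟨d, hd⟩ : ∃ d : ℕ, (red F).order = d :=
    ENat.ne_top_iff_exists.mp (PowerSeries.order_finite_iff_ne_zero.mpr hne).ne |>.imp fun d hd => hd.symm
  obtain ⟨q, r, hqr⟩ := h (2 * (d + 1)) ⟨d + 1, two_mul _⟩
  have hdvd := X_pow_dvd_red_of_layer hqr
  have hdeg := div_two_le_natDegree_cyclotomicOmegaPlus p (2 * (d + 1))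
  rw [Nat.mul_div_cancel_left _ two_pos] at hdeg
  have hle : ((1 + (cyclotomicOmegaPlus p (2 * (d + 1))).natDegree : ℕ) : ℕ∞) ≤ (red F).order := by
    obtain ⟨s, hs⟩ := hdvd
    rw [hs, PowerSeries.order_mul, PowerSeries.order_X_pow]
    exact le_self_add
  rw [hd, Nat.cast_le] at hle
  omega

/-- **The limit argument**: if `ω_n^-·F ∈ (p^k, ω_n)Λ` for every even `n`, then `p^k ∣ F` (induction on `k`:
peel one `p` with the `k = 1` case, cancel it against `ω_n`, which is prime to `p`).
[cite: GreenbergVatsal2000, §3] [cite: EmertonPollackWeston2006, Thm. 1] -/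
theorem C_pow_dvd_of_forall_even (k : ℕ) :
    ∀ {F : IwasawaAlgebra p}, (∀ n : ℕ, Even n → ∃ q r : IwasawaAlgebra p,
      toIwasawa p (cyclotomicOmegaMinus p n) * F =
        PowerSeries.C ((p : ℤ_[p]) ^ k) * q + toIwasawa p (cyclotomicOmega p n) * r) →
      PowerSeries.C ((p : ℤ_[p]) ^ k) ∣ F := by
  induction k with
  | zero => intro F _; rw [pow_zero, map_one]; exact one_dvd _
  | succ k ih =>
    intro F h
    have h1 : PowerSeries.C (p : ℤ_[p]) ∣ F := by
      refine C_p_dvd_of_forall_even fun n hn => ?_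
      obtain ⟨q, r, e⟩ := h n hn
      exact ⟨PowerSeries.C ((p : ℤ_[p]) ^ k) * q, r, by rw [e, pow_succ', map_mul, mul_assoc]⟩
    obtain ⟨F₁, rfl⟩ := h1
    have h2 : ∀ n : ℕ, Even n → ∃ q r : IwasawaAlgebra p, toIwasawa p (cyclotomicOmegaMinus p n) * F₁ =
        PowerSeries.C ((p : ℤ_[p]) ^ k) * q + toIwasawa p (cyclotomicOmega p n) * r := by
      intro n hn
      obtain ⟨q, r, e⟩ := h n hn
      have hr : PowerSeries.C (p : ℤ_[p]) ∣ toIwasawa p (cyclotomicOmega p n) * r := by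
        refine ⟨toIwasawa p (cyclotomicOmegaMinus p n) * F₁ - PowerSeries.C ((p : ℤ_[p]) ^ k) * q, ?_⟩
        rw [pow_succ', map_mul] at e
        linear_combination -e
      obtain ⟨r₁, rfl⟩ := C_p_dvd_of_dvd_omega_mul hr
      refine ⟨q, r₁, mul_left_cancel₀ (C_pow_ne_zero (p := p) 1) ?_⟩
      rw [pow_one]
      rw [pow_succ', map_mul] at e
      linear_combination e
    obtain ⟨t, ht⟩ := ih h2
    exact ⟨t, by rw [ht, pow_succ', map_mul]; ring⟩

/-! ## §3. From a layer-`n` congruence of (normalised, non-primitive) Mazur–Tate elements to `ω·(…) ∈ (p^k, ω_n)Λ` -/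

/-- **Clearing the interpolation**: if `θ ≡ ω·L (mod ω_n)` in `Λ ⊗ ℚ_p` (`IsCongrModOmega`) and `ι G = c·ι L`
(`c ∈ ℚ_p`, `G ∈ Λ` an integral multiple of `c·L`), then for every `P ∈ Λ` some `p^B·(c·θ·ι P)` is
`p^B·ι(ω·G·P)` plus an INTEGRAL multiple of `ω_n`: `∃ B s, p^B·c·θ·ιP = p^B·ι(ω G P) + ι(ω_n s)`.
[cite: Pollack2003, Prop. 6.18] -/
theorem exists_shift_of_isCongrModOmega {n : ℕ} {θ : ℚ[X]} {ω : ℤ[X]} {L G P : IwasawaAlgebra p} {c : ℚ_[p]}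
    (hL : IsCongrModOmega p n θ ω L) (hG : iwasawaToPowerSeries p G = PowerSeries.C c * iwasawaToPowerSeries p L) :
    ∃ (B : ℕ) (s : IwasawaAlgebra p),
      PowerSeries.C ((p : ℚ_[p]) ^ B) * (PowerSeries.C c * (θ.map (algebraMap ℚ ℚ_[p]) : PowerSeries ℚ_[p]) *
          iwasawaToPowerSeries p P) =
        PowerSeries.C ((p : ℚ_[p]) ^ B) * iwasawaToPowerSeries p (toIwasawa p ω * G * P) +
          iwasawaToPowerSeries p (toIwasawa p (cyclotomicOmega p n) * s) := by
  obtain ⟨a, q₁, hq₁⟩ := hL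
  obtain ⟨b, y, hy⟩ := exists_pow_mul_eq_coe (p := p) c
  rw [← toIwasawa_apply, ← toIwasawa_apply] at hq₁
  set ι := iwasawaToPowerSeries p with hι
  refine ⟨a + b, PowerSeries.C y * q₁ * P, ?_⟩
  have hιC : ∀ x : ℤ_[p], ι (PowerSeries.C x) = PowerSeries.C (x : ℚ_[p]) := fun x => by
    rw [hι, PowerSeries.map_C]; rfl
  have hyC : PowerSeries.C (p : ℚ_[p]) ^ b * PowerSeries.C c = PowerSeries.C (y : ℚ_[p]) := by
    rw [← map_pow, ← map_mul, hy]
  simp only [map_mul, map_pow, hιC] at hq₁ hG ⊢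
  linear_combination PowerSeries.C (p : ℚ_[p]) ^ b * PowerSeries.C c * ι P * hq₁ -
    PowerSeries.C (p : ℚ_[p]) ^ (a + b) * ι (toIwasawa p ω) * ι P * hG +
    ι (toIwasawa p (cyclotomicOmega p n)) * ι q₁ * ι P * hyC

/-- **From a layer-`n` Mazur–Tate congruence to `ω·(D·G·P − D'·G'·P') ∈ (p^k, ω_n)Λ`.** Let `θ ≡ ω L`, `θ' ≡ ω L'`
`(mod ω_n)` in `Λ ⊗ ℚ_p` (Pollack's interpolation at the same layer and sign on both sides), `ι G = c·ι L`,
`ι G' = c'·ι L'` (integral multiples of the normalised functions), `P, P' ∈ Λ` (Euler-factor products), `D, D' ∈ ℤ_p`.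
If the normalised elements satisfy `D·(c θ ιP) − D'·(c' θ' ιP') ∈ ι((p^k, ω_n)Λ)`, then
`ω·(D·G·P − D'·G'·P') ∈ (p^k, ω_n)Λ`. (Clear denominators with `exists_shift_of_isCongrModOmega`, use injectivity
of `ι`, and cancel the `p`-power against `ω_n`, §1.) [cite: Vatsal1999, Thm. (1.10)] [cite: Pollack2003, Prop. 6.18] -/
theorem omega_mul_mem_of_layerCongr {n k : ℕ} {θ θ' : ℚ[X]} {ω : ℤ[X]}
    {L L' G G' P P' q r : IwasawaAlgebra p} {c c' : ℚ_[p]} {D D' : ℤ_[p]}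
    (hL : IsCongrModOmega p n θ ω L) (hL' : IsCongrModOmega p n θ' ω L')
    (hG : iwasawaToPowerSeries p G = PowerSeries.C c * iwasawaToPowerSeries p L)
    (hG' : iwasawaToPowerSeries p G' = PowerSeries.C c' * iwasawaToPowerSeries p L')
    (hMT : PowerSeries.C (D : ℚ_[p]) *
        (PowerSeries.C c * (θ.map (algebraMap ℚ ℚ_[p]) : PowerSeries ℚ_[p]) * iwasawaToPowerSeries p P) -
      PowerSeries.C (D' : ℚ_[p]) *
        (PowerSeries.C c' * (θ'.map (algebraMap ℚ ℚ_[p]) : PowerSeries ℚ_[p]) * iwasawaToPowerSeries p P') =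
      iwasawaToPowerSeries p (PowerSeries.C ((p : ℤ_[p]) ^ k) * q + toIwasawa p (cyclotomicOmega p n) * r)) :
    ∃ q' r' : IwasawaAlgebra p, toIwasawa p ω * (PowerSeries.C D * (G * P) - PowerSeries.C D' * (G' * P')) =
      PowerSeries.C ((p : ℤ_[p]) ^ k) * q' + toIwasawa p (cyclotomicOmega p n) * r' := by
  obtain ⟨B, s, hs⟩ := exists_shift_of_isCongrModOmega (P := P) hL hG
  obtain ⟨B', s', hs'⟩ := exists_shift_of_isCongrModOmega (P := P') hL' hG'
  set ι := iwasawaToPowerSeries p with hι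
  set Ω := toIwasawa p ω with hΩ
  set Ωn := toIwasawa p (cyclotomicOmega p n) with hΩn
  set X := PowerSeries.C D * (G * P) - PowerSeries.C D' * (G' * P') with hX
  have hιC : ∀ x : ℤ_[p], ι (PowerSeries.C x) = PowerSeries.C (x : ℚ_[p]) := fun x => by
    rw [hι, PowerSeries.map_C]; rfl
  -- multiply the layer congruence by `p^{B+B'}` and substitute the two shifts: an identity inside `ι(Λ)`, pulled back
  have key : PowerSeries.C ((p : ℤ_[p]) ^ (B + B')) * (Ω * X) +
      Ωn * (PowerSeries.C ((p : ℤ_[p]) ^ B') * PowerSeries.C D * s -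
        PowerSeries.C ((p : ℤ_[p]) ^ B) * PowerSeries.C D' * s') =
      PowerSeries.C ((p : ℤ_[p]) ^ (B + B')) * (PowerSeries.C ((p : ℤ_[p]) ^ k) * q + Ωn * r) := by
    apply iwasawaToPowerSeries_injective p
    rw [← hι]
    simp only [hX, map_add, map_sub, map_mul, map_pow, hιC, PadicInt.coe_natCast] at hs hs' hMT ⊢
    linear_combination PowerSeries.C (p : ℚ_[p]) ^ (B + B') * hMT -
      PowerSeries.C (p : ℚ_[p]) ^ B' * PowerSeries.C (D : ℚ_[p]) * hs +
      PowerSeries.C (p : ℚ_[p]) ^ B * PowerSeries.C (D' : ℚ_[p]) * hs'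
  -- `p^{B+B'}` divides `ω_n·(…)`, hence `(…)` itself (§1); cancel it
  have hdvd : PowerSeries.C ((p : ℤ_[p]) ^ (B + B')) ∣
      Ωn * (PowerSeries.C ((p : ℤ_[p]) ^ B') * PowerSeries.C D * s -
        PowerSeries.C ((p : ℤ_[p]) ^ B) * PowerSeries.C D' * s') :=
    ⟨PowerSeries.C ((p : ℤ_[p]) ^ k) * q + Ωn * r - Ω * X, by linear_combination key⟩
  obtain ⟨t, ht⟩ := C_pow_dvd_of_dvd_omega_mul (B + B') hdvd
  refine ⟨q, r - t, mul_left_cancel₀ (C_pow_ne_zero (p := p) (B + B')) ?_⟩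
  rw [ht] at key
  linear_combination key

end Summit.BirchSwinnertonDyer.BirchSwinnertonDyer.Theorems.SignedTransportAtTwo

end
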